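import Mathlib
import Summits.AtomisticToContinuum.Crystallization.Theorems.FrustratedLawDichotomyPeriodicSubconfiguration
import Summits.AtomisticToContinuum.Crystallization.Theorems.FrustratedLawDichotomyPeriodicSupercell
import Summits.AtomisticToContinuum.Crystallization.Theorems.ChargedEnergyGap.Negative.BlocksLocal

/-!
# FrustratedLawDichotomy · cruxes `AperiodicFrustratedLawGap` / `PeriodicFrustratedLawGap` (stmt-AtomisticToContinuum-27623 / 27624) —
# THE UNCONDITIONAL `k`-ATOM REMOVAL TEST FOR EXACT PERIODIC MINIMISERS (periodic case of the μ-equilibrium door, removals, door-free)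
# (decomp-a2c, prover hand 2, structural share, generation 5)

`eStar_lt_energyPerParticle_of_underboundCluster_periodic`: let `Q` be a `δ`-separated periodic configuration of `ℝ³` and `xf` a finite
cluster of `n` distinct atoms of `Q`.  If the cluster is UNDERBOUND relative to `e(Q)` — `U(xf) + I(xf, Q ∖ xf) > e(Q)·n`, i.e. removing it from
the infinite configuration would lower `U − e(Q)·#` — then `e⋆ < e(Q)`: `Q` is not an exact Lennard-Jones minimiser.  Equivalently an exact
periodic minimiser satisfies EVERY removal inequality of an `e⋆`-μGSC (Sütő), for all `k = 0`, `n ≥ 1` surgeries, EXACTLY (no `½R` correction: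
compare the one-atom law-level floor `periodic_bindingFloor` of generation 4) and WITHOUT the μ-equilibrium door of item 27073 (compare the
door-conditional `FrustratedLawDichotomyGSCSurgeryTests.eStar_lt_energyPerParticle_of_surgery`).

Proof (sub-motif removal in a supercell).  Re-present `Q` with lattice `KΛ` (`FrustratedLawDichotomyPeriodicSupercell.exists_supercell_points_energy`,
adapted from `PhononSlackCertificatesNearFarGlueRSupercell`: same points, same energy) with `Kδ > 2ρ + 1`, `ρ = Σ‖xf i‖`; the `n` atoms have pairwise `KΛ`-inequivalent motif representatives; delete
them from the motif.  The new periodic configuration `A` (points `Q ∖ (xf + KΛ)`) has `e⋆ ≤ e(A)`, and by the site-sum bookkeeping of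
`FrustratedLawDichotomyPeriodicSubconfiguration` `2·#A·e(A) = 2·#M'·e(Q) − 2Σ_i I(xf i, A) − 2U(xf) − Σ_i G_i`, where `G_i ≤ 0` collects
the bonds of `xf i` to the far lattice copies of the cluster (all at distance `≥ Kδ − 2ρ ≥ 1`, where `V_LJ ≤ 0`) and `I(xf i, Q∖xf) = I(xf i, A) + G_i`.
If `e(Q) ≤ e⋆` this gives `U(xf) + I(xf, Q∖xf) ≤ e(Q)·n`.  All `[folklore]`.
-/

noncomputable section

namespace Summit.AtomisticToContinuum.Crystallization.Theorems.FrustratedLawDichotomyPeriodicRemovalTest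

open Literature.MathematicalPhysics.StatisticalMechanics
open Summit.AtomisticToContinuum.Crystallization.Theorems.ChargedEnergyGapNegative (E3 eStar eStar_le)
open Summit.AtomisticToContinuum.Crystallization.Theorems.FrustratedLawDichotomyPeriodicSubconfiguration
open Summit.AtomisticToContinuum.Crystallization.Theorems.FrustratedLawDichotomyPeriodicSupercell (exists_supercell_points_energy tsum_site_eq_of_sub_mem_lattice)

/-- In a `δ`-separated periodic configuration every non-zero period has norm `≥ δ`. [folklore] -/
theorem le_norm_of_mem_lattice (Q : PeriodicConfiguration 3) {δ : ℝ}
    (hsep : ∀ p ∈ Q.points, ∀ q ∈ Q.points, p ≠ q → δ ≤ dist p q) {g : E3} (hg : g ∈ Q.lattice) (hg0 : g ≠ 0) :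
    δ ≤ ‖g‖ := by
  obtain ⟨y, hy⟩ := Q.motif_nonempty
  have h1 : y ∈ Q.points := Q.mem_points_of_mem_motif hy
  have h2 : y + g ∈ Q.points := Q.add_mem_points h1 hg
  have h := hsep (y + g) h2 y h1 (fun h => hg0 (by simpa using h))
  rwa [dist_eq_norm, add_sub_cancel_left] at h

/-- **UNCONDITIONAL `k`-ATOM REMOVAL TEST FOR PERIODIC CANDIDATES.**  A `δ`-separated periodic configuration `Q` of `ℝ³` containing a finite
cluster `xf` of `n` distinct atoms with `U(xf) + I(xf, Q ∖ xf) > e(Q)·n` has `e⋆ < e(Q)`.  (Sub-motif removal in a supercell; no door, no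
bound on `e⋆`.) [folklore] -/
theorem eStar_lt_energyPerParticle_of_underboundCluster_periodic (Q : PeriodicConfiguration 3)
    {δ : ℝ} (hδ : 0 < δ) (hsep : ∀ p ∈ Q.points, ∀ q ∈ Q.points, p ≠ q → δ ≤ dist p q)
    {n : ℕ} {xf : Fin n → E3} (hxf : Function.Injective xf) (hX : Set.range xf ⊆ Q.points)
    (hviol : Q.energyPerParticle lennardJones * n <
      interactionEnergy lennardJones xf + ∑ i, ∑' y : ↥(Q.points \ Set.range xf), lennardJones (dist (xf i) y)) :
    (⨅ Q' : PeriodicConfiguration 3, Q'.energyPerParticle lennardJones) < Q.energyPerParticle lennardJones := by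
  classical
  by_contra hle
  rw [not_lt] at hle
  set e : ℝ := Q.energyPerParticle lennardJones with he_def
  have heq : e = ⨅ Q' : PeriodicConfiguration 3, Q'.energyPerParticle lennardJones := le_antisymm hle (eStar_le Q)
  -- n = 0 is impossible
  rcases Nat.eq_zero_or_pos n with hn0 | hnpos
  · subst hn0
    rw [interactionEnergy_of_subsingleton, Finset.sum_of_isEmpty] at hviol
    simp at hviol
  -- size of the cluster and a lattice direction
  set ρ : ℝ := ∑ i, ‖xf i‖ with hρ_def
  have hρi : ∀ i, ‖xf i‖ ≤ ρ := fun i =>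
    Finset.single_le_sum (f := fun i => ‖xf i‖) (fun _ _ => norm_nonneg _) (Finset.mem_univ i)
  have hdij : ∀ i j, ‖xf i - xf j‖ ≤ 2 * ρ := fun i j =>
    (norm_sub_le _ _).trans (by linarith [hρi i, hρi j])
  obtain ⟨g₁, hg₁Λ, hg₁0⟩ : ∃ g ∈ Q.lattice, g ≠ 0 :=
    ⟨_, Summit.AtomisticToContinuum.Crystallization.Theorems.ChargedEnergyGapNegative.Blocks.latVec_mem Q (fun _ => 1),
      Summit.AtomisticToContinuum.Crystallization.Theorems.ChargedEnergyGapNegative.Blocks.latVec_one_ne_zero Q⟩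
  have hg₁ : δ ≤ ‖g₁‖ := le_norm_of_mem_lattice Q hsep hg₁Λ hg₁0
  have hg₁pos : 0 < ‖g₁‖ := hδ.trans_le hg₁
  -- an integer multiple of `g₁` longer than the cluster, and the supercell factor
  obtain ⟨N, hN⟩ := exists_nat_gt (2 * ρ / ‖g₁‖)
  have hNg : 2 * ρ < (N : ℝ) * ‖g₁‖ := by rwa [div_lt_iff₀ hg₁pos] at hN
  obtain ⟨k, hk⟩ := exists_nat_gt ((2 * ρ + (N : ℝ) * ‖g₁‖ + 1) / δ)
  set K : ℕ := k + 1 with hK_def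
  have hKk : ((2 * ρ + (N : ℝ) * ‖g₁‖ + 1) / δ) < (K : ℝ) := hk.trans (by rw [hK_def]; push_cast; linarith)
  have hKδ : 2 * ρ + (N : ℝ) * ‖g₁‖ + 1 < (K : ℝ) * δ := by rwa [div_lt_iff₀ hδ] at hKk
  have hρ0 : 0 ≤ ρ := Finset.sum_nonneg fun _ _ => norm_nonneg _
  have hN0 : 0 ≤ (N : ℝ) * ‖g₁‖ := by positivity
  -- the supercell re-presentation
  obtain ⟨P, hpts, hen, hlat⟩ := exists_supercell_points_energy Q K
  have heP : P.energyPerParticle lennardJones = e := by rw [he_def, hen]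
  -- non-zero periods of `P` are long
  have hlong : ∀ g ∈ P.lattice, g ≠ 0 → (K : ℝ) * δ ≤ ‖g‖ := by
    intro g hg hg0
    obtain ⟨g₀, hg₀, rfl⟩ := (hlat g).1 hg
    have hg₀0 : g₀ ≠ 0 := fun h => hg0 (by rw [h, smul_zero])
    rw [norm_smul, Real.norm_natCast]
    exact mul_le_mul_of_nonneg_left (le_norm_of_mem_lattice Q hsep hg₀ hg₀0) (Nat.cast_nonneg K)
  -- short vectors of `P.lattice` vanish
  have hshort : ∀ g ∈ P.lattice, ‖g‖ < (K : ℝ) * δ → g = 0 := fun g hg hlt => by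
    by_contra h; exact absurd (hlong g hg h) (not_le.2 hlt)
  -- motif representatives of the cluster atoms
  have hxP : ∀ i, xf i ∈ P.points := fun i => by rw [hpts]; exact hX (Set.mem_range_self i)
  choose m hm l hl hx using hxP
  have hminj : Function.Injective m := by
    intro i j hij
    apply hxf
    have h1 : xf i - xf j = l i - l j := by rw [hx i, hx j, hij]; abel
    have h2 : l i - l j ∈ P.lattice := P.lattice.sub_mem (hl i) (hl j)
    have h3 : ‖l i - l j‖ < (K : ℝ) * δ := by rw [← h1]; linarith [hdij i j]
    have h4 := hshort _ h2 h3
    rw [← sub_eq_zero, h1, h4]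
  -- the removed sub-motif `Bset` and the kept sub-motif `Aset`
  set Bset : Finset E3 := Finset.univ.image m with hBset
  set Aset : Finset E3 := P.motif \ Bset with hAset
  have hBsub : Bset ⊆ P.motif := by
    intro b hb; obtain ⟨i, -, rfl⟩ := Finset.mem_image.1 hb; exact hm i
  have hAsub : Aset ⊆ P.motif := Finset.sdiff_subset
  have hcover : ∀ x ∈ P.motif, x ∈ Aset ∨ x ∈ Bset := fun x hx => by
    by_cases h : x ∈ Bset
    · exact Or.inr h
    · exact Or.inl (Finset.mem_sdiff.2 ⟨hx, h⟩)
  have hABdisj : Disjoint Aset Bset := Finset.sdiff_disjoint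
  have hBne : Bset.Nonempty := ⟨m ⟨0, hnpos⟩, Finset.mem_image_of_mem m (Finset.mem_univ _)⟩
  -- a point of `Q` outside every removed orbit, hence `Aset` is non-empty
  have hAne : Aset.Nonempty := by
    set q₀ : E3 := xf ⟨0, hnpos⟩ + (N : ℝ) • g₁ with hq₀
    have hq₀Q : q₀ ∈ P.points := by
      rw [hpts, hq₀, Nat.cast_smul_eq_nsmul ℝ N g₁]
      exact Q.add_mem_points (hX (Set.mem_range_self _)) (nsmul_mem hg₁Λ N)
    obtain ⟨y, hy, g, hg, hyg⟩ := hq₀Q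
    refine ⟨y, Finset.mem_sdiff.2 ⟨hy, fun hyB => ?_⟩⟩
    obtain ⟨j, -, hj⟩ := Finset.mem_image.1 hyB
    -- then `q₀ - xf j ∈ P.lattice`, a short non-zero period: contradiction
    have hdiff : q₀ - xf j = g - l j := by rw [hyg, hx j, ← hj]; abel
    have hmem : q₀ - xf j ∈ P.lattice := by rw [hdiff]; exact P.lattice.sub_mem hg (hl j)
    have hnorm_le : ‖q₀ - xf j‖ < (K : ℝ) * δ := by
      have : q₀ - xf j = (xf ⟨0, hnpos⟩ - xf j) + (N : ℝ) • g₁ := by rw [hq₀]; abel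
      rw [this]
      refine (norm_add_le _ _).trans_lt ?_
      rw [norm_smul, Real.norm_natCast]
      linarith [hdij ⟨0, hnpos⟩ j]
    have hnorm_pos : 0 < ‖q₀ - xf j‖ := by
      have : q₀ - xf j = (N : ℝ) • g₁ + (xf ⟨0, hnpos⟩ - xf j) := by rw [hq₀]; abel
      rw [this]
      have h1 : ‖(N : ℝ) • g₁‖ - ‖xf ⟨0, hnpos⟩ - xf j‖ ≤ ‖(N : ℝ) • g₁ + (xf ⟨0, hnpos⟩ - xf j)‖ := norm_sub_le_norm_add _ _
      rw [norm_smul, Real.norm_natCast] at h1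
      linarith [hdij ⟨0, hnpos⟩ j]
    have := hshort _ hmem hnorm_le
    rw [this, norm_zero] at hnorm_pos
    exact lt_irrefl _ hnorm_pos
  -- the two sub-configurations
  let A : PeriodicConfiguration 3 :=
    { lattice := P.lattice, discrete := P.discrete, isZLattice := P.isZLattice, motif := Aset, motif_nonempty := hAne,
      eq_of_sub_mem := fun x hx y hy h => P.eq_of_sub_mem x (hAsub hx) y (hAsub hy) h }
  let B : PeriodicConfiguration 3 :=
    { lattice := P.lattice, discrete := P.discrete, isZLattice := P.isZLattice, motif := Bset, motif_nonempty := hBne,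
      eq_of_sub_mem := fun x hx y hy h => P.eq_of_sub_mem x (hBsub hx) y (hBsub hy) h }
  have hAl : A.lattice = P.lattice := rfl
  have hBl : B.lattice = P.lattice := rfl
  have hunion : P.points = A.points ∪ B.points := points_eq_union hAl hBl hAsub hBsub hcover
  have hdisjAB : Disjoint A.points B.points := disjoint_points hAl hBl hAsub hBsub hABdisj
  -- description of the removed point set
  have hBpts : ∀ z : E3, z ∈ B.points ↔ ∃ j, ∃ g ∈ P.lattice, z = xf j + g := by
    intro z
    constructor
    · rintro ⟨b, hb, g, hg, rfl⟩
      obtain ⟨j, -, rfl⟩ := Finset.mem_image.1 hb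
      refine ⟨j, g - l j, P.lattice.sub_mem hg (hl j), ?_⟩
      rw [hx j]; abel
    · rintro ⟨j, g, hg, rfl⟩
      refine ⟨m j, Finset.mem_image_of_mem m (Finset.mem_univ j), g + l j, P.lattice.add_mem hg (hl j), ?_⟩
      rw [hx j]; abel
  have hxB : ∀ i, xf i ∈ B.points := fun i => (hBpts _).2 ⟨i, 0, P.lattice.zero_mem, (add_zero _).symm⟩
  have hxA : ∀ i, xf i ∉ A.points := fun i h => Set.disjoint_left.1 hdisjAB h (hxB i)
  have hmB : ∀ i, m i ∈ B.points := fun i => B.mem_points_of_mem_motif (Finset.mem_image_of_mem m (Finset.mem_univ i))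
  have hmA : ∀ i, m i ∉ A.points := fun i h => Set.disjoint_left.1 hdisjAB h (hmB i)
  have haB : ∀ x ∈ Aset, x ∉ B.points := fun x hx h => Set.disjoint_left.1 hdisjAB (A.mem_points_of_mem_motif hx) h
  -- far copies: a removed point other than the cluster atoms is at distance `≥ 1` from every cluster atom
  have hfar : ∀ z ∈ B.points, z ∉ Set.range xf → ∀ i, 1 ≤ dist (xf i) z := by
    intro z hz hzr i
    obtain ⟨j, g, hg, rfl⟩ := (hBpts z).1 hz
    have hg0 : g ≠ 0 := fun h => hzr ⟨j, by rw [h, add_zero]⟩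
    have h1 := hlong g hg hg0
    have h2 : ‖g‖ - ‖xf i - xf j‖ ≤ dist (xf i) (xf j + g) := by
      rw [dist_eq_norm, show xf i - (xf j + g) = (xf i - xf j) - g by abel, norm_sub_rev (xf i - xf j) g]
      exact norm_sub_norm_le _ _ |>.trans (le_of_eq (by rw [norm_sub_rev]))
    linarith [hdij i j]
  -- notation for the site-type sums
  set siteP : E3 → ℝ := fun x => ∑' y : {y : E3 // y ∈ P.points ∧ y ≠ x}, lennardJones (dist x y.1) with hsiteP
  set siteA : E3 → ℝ := fun x => ∑' y : {y : E3 // y ∈ A.points ∧ y ≠ x}, lennardJones (dist x y.1) with hsiteA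
  set siteB : E3 → ℝ := fun x => ∑' y : {y : E3 // y ∈ B.points ∧ y ≠ x}, lennardJones (dist x y.1) with hsiteB
  set G : Fin n → ℝ := fun i => ∑' z : ↥(B.points \ Set.range xf), lennardJones (dist (xf i) z) with hG
  set I : Fin n → ℝ := fun i => ∑' y : ↥(Q.points \ Set.range xf), lennardJones (dist (xf i) y) with hI
  -- (E1) energy of `P` (= of `Q`) as a sum of site sums, split along the motif
  have hE1 : 2 * (P.motif.card : ℝ) * e = ∑ x ∈ Aset, siteP x + ∑ x ∈ Bset, siteP x := by
    rw [← heP, twice_card_mul_energyPerParticle, ← Finset.sum_union hABdisj, hAset, Finset.sdiff_union_of_subset hBsub]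
  -- (E3) the removed representatives have the site sums of the cluster atoms
  have hE3 : ∑ x ∈ Bset, siteP x = ∑ i, siteP (xf i) := by
    rw [hBset, Finset.sum_image (fun i _ j _ h => hminj h)]
    refine Finset.sum_congr rfl fun i _ => ?_
    simp only [hsiteP]
    exact (tsum_site_eq_of_sub_mem_lattice P lennardJones (x := m i) (x' := xf i)
      (by rw [hx i, add_sub_cancel_left]; exact hl i)).symm
  -- (E4) energy of `A`, bounded below by `e⋆ = e`
  have hE4 : 2 * (Aset.card : ℝ) * A.energyPerParticle lennardJones = ∑ x ∈ Aset, siteA x :=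
    twice_card_mul_energyPerParticle A lennardJones
  have hE4' : 2 * (Aset.card : ℝ) * e ≤ 2 * (Aset.card : ℝ) * A.energyPerParticle lennardJones := by
    have h0 : (⨅ Q' : PeriodicConfiguration 3, Q'.energyPerParticle lennardJones) ≤ A.energyPerParticle lennardJones := eStar_le A
    have h1 : e ≤ A.energyPerParticle lennardJones := heq ▸ h0
    have h2 : (0 : ℝ) ≤ 2 * (Aset.card : ℝ) := mul_nonneg (by norm_num) (Nat.cast_nonneg _)
    exact mul_le_mul_of_nonneg_left h1 h2
  -- (E5) site split for the kept motif points
  have hE5 : ∑ x ∈ Aset, siteP x = ∑ x ∈ Aset, siteA x + ∑ x ∈ Aset, siteB x := by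
    rw [← Finset.sum_add_distrib]
    exact Finset.sum_congr rfl fun x _ => tsum_site_split P hunion hdisjAB x
  -- (E6–E8) the cross term, counted from the removed side
  set SA : Fin n → ℝ := fun i => ∑' z : {z : E3 // z ∈ A.points ∧ z ≠ xf i}, lennardJones (dist (xf i) z.1) with hSA
  have hE6 : ∀ x ∈ Aset, siteB x = ∑ i, ∑' l : ↥P.lattice, lennardJones (dist (m i) (x + (l : E3))) := by
    intro x hx
    simp only [hsiteB]
    rw [tsum_points_eq_sum_tsum_lattice B (haB x hx)]
    show ∑ b ∈ Bset, ∑' l : ↥P.lattice, lennardJones (dist x (b + (l : E3))) = _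
    rw [hBset, Finset.sum_image (fun i _ j _ h => hminj h)]
    exact Finset.sum_congr rfl fun i _ => tsum_lattice_symm P.lattice lennardJones x (m i)
  have hE8 : ∀ i, ∑ x ∈ Aset, ∑' l : ↥P.lattice, lennardJones (dist (m i) (x + (l : E3))) = SA i := by
    intro i
    have h1 := tsum_points_eq_sum_tsum_lattice A (hmA i)
    -- `h1 : Σ'_{z ∈ A.pts, z ≠ m i} V(dist (m i) z) = Σ_{x ∈ Aset} Σ'_ℓ V(dist (m i) (x + ℓ))`
    rw [← h1]
    simp only [hSA]
    exact (tsum_site_eq_of_sub_mem_lattice A lennardJones (x := m i) (x' := xf i)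
      (by rw [hx i, add_sub_cancel_left]; exact hl i)).symm
  have hE68 : ∑ x ∈ Aset, siteB x = ∑ i, SA i := by
    rw [Finset.sum_congr rfl hE6, Finset.sum_comm]
    exact Finset.sum_congr rfl fun i _ => hE8 i
  -- (E9) site split at the cluster atoms
  have hE9 : ∀ i, siteP (xf i) = SA i + siteB (xf i) := fun i => tsum_site_split P hunion hdisjAB (xf i)
  -- (E10) the removed side seen from a cluster atom: the other cluster atoms plus far copies
  have hsetB : ∀ i, {z : E3 | z ∈ B.points ∧ z ≠ xf i} =
      (↑((Finset.univ.erase i).image xf) : Set E3) ∪ (B.points \ Set.range xf) := by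
    intro i
    ext z
    rw [Set.mem_setOf_eq, Set.mem_union, Finset.mem_coe, Finset.mem_image, Set.mem_sdiff, Set.mem_range]
    constructor
    · rintro ⟨hz, hzi⟩
      by_cases hr : ∃ j, xf j = z
      · obtain ⟨j, rfl⟩ := hr
        exact Or.inl ⟨j, Finset.mem_erase.2 ⟨fun h => hzi (by rw [h]), Finset.mem_univ j⟩, rfl⟩
      · exact Or.inr ⟨hz, hr⟩
    · rintro (⟨j, hj, rfl⟩ | ⟨hz, hr⟩)
      · exact ⟨hxB j, fun h => (Finset.mem_erase.1 hj).1 (hxf h)⟩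
      · exact ⟨hz, fun h => hr ⟨i, h.symm⟩⟩
  have hdisjB : ∀ i, Disjoint (↑((Finset.univ.erase i).image xf) : Set E3) (B.points \ Set.range xf) := by
    intro i
    rw [Set.disjoint_left]
    rintro z hz ⟨-, hr⟩
    rw [Finset.mem_coe, Finset.mem_image] at hz
    obtain ⟨j, -, rfl⟩ := hz
    exact hr ⟨j, rfl⟩
  have hE10 : ∀ i, siteB (xf i) = ∑ j ∈ Finset.univ.erase i, lennardJones (dist (xf i) (xf j)) + G i := by
    intro i
    simp only [hsiteB, hG]
    have hS1 : Summable ((fun z : E3 => lennardJones (dist (xf i) z)) ∘ (↑) : (↑((Finset.univ.erase i).image xf) : Set E3) → ℝ) :=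
      summable_lennardJones_subset P (xf i) (fun z hz => by
        have hz' : z ∈ {z : E3 | z ∈ B.points ∧ z ≠ xf i} := by rw [hsetB i]; exact Or.inl hz
        exact ⟨by rw [hunion]; exact Or.inr hz'.1, hz'.2⟩)
    have hS2 : Summable ((fun z : E3 => lennardJones (dist (xf i) z)) ∘ (↑) : (B.points \ Set.range xf : Set E3) → ℝ) :=
      summable_lennardJones_subset P (xf i) (fun z hz => by
        have hz' : z ∈ {z : E3 | z ∈ B.points ∧ z ≠ xf i} := by rw [hsetB i]; exact Or.inr hz
        exact ⟨by rw [hunion]; exact Or.inr hz'.1, hz'.2⟩)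
    have h := hS1.tsum_union_disjoint (hdisjB i) hS2
    rw [← tsum_congr_set_coe (fun z : E3 => lennardJones (dist (xf i) z)) (hsetB i)] at h
    have hfin : ∑' x : (↑((Finset.univ.erase i).image xf) : Set E3), lennardJones (dist (xf i) x) =
        ∑ x ∈ (Finset.univ.erase i).image xf, lennardJones (dist (xf i) x) :=
      Finset.tsum_subtype' _ (fun z => lennardJones (dist (xf i) z))
    rw [hfin, Finset.sum_image (fun j _ k _ hjk => hxf hjk)] at h
    exact h
  have hGle : ∀ i, G i ≤ 0 := fun i => by
    simp only [hG]
    exact tsum_nonpos fun z => lennardJones_nonpos (hfar z.1 z.2.1 z.2.2 i)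
  -- (E11) the field over `Q ∖ xf` splits into the kept configuration and the far copies
  have hsetQ : Q.points \ Set.range xf = A.points ∪ (B.points \ Set.range xf) := by
    rw [← hpts, hunion]
    ext z
    simp only [Set.mem_sdiff, Set.mem_union]
    constructor
    · rintro ⟨hz | hz, hr⟩
      · exact Or.inl hz
      · exact Or.inr ⟨hz, hr⟩
    · rintro (hz | ⟨hz, hr⟩)
      · refine ⟨Or.inl hz, fun ⟨j, hj⟩ => hxA j ?_⟩
        rw [hj]; exact hz
      · exact ⟨Or.inr hz, hr⟩
  have hdisjQ : Disjoint A.points (B.points \ Set.range xf) :=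
    Set.disjoint_of_subset_right Set.sdiff_subset hdisjAB
  have hE11 : ∀ i, I i = SA i + G i := by
    intro i
    simp only [hI, hSA, hG]
    have hS1 : Summable ((fun z : E3 => lennardJones (dist (xf i) z)) ∘ (↑) : A.points → ℝ) :=
      summable_lennardJones_subset P (xf i) (fun z hz => ⟨by rw [hunion]; exact Or.inl hz, fun h => hxA i (h ▸ hz)⟩)
    have hS2 : Summable ((fun z : E3 => lennardJones (dist (xf i) z)) ∘ (↑) : (B.points \ Set.range xf : Set E3) → ℝ) :=
      summable_lennardJones_subset P (xf i) (fun z hz => ⟨by rw [hunion]; exact Or.inr hz.1, fun h => hz.2 ⟨i, h.symm⟩⟩)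
    have h := hS1.tsum_union_disjoint hdisjQ hS2
    rw [← tsum_congr_set_coe (fun z : E3 => lennardJones (dist (xf i) z)) hsetQ] at h
    rw [← tsum_congr_set_coe (fun z : E3 => lennardJones (dist (xf i) z)) (setOf_points_ne_eq (hxA i))] at h
    exact h
  -- (E12) double counting of the cluster's internal energy
  have hE12 : 2 * interactionEnergy lennardJones xf = ∑ i, ∑ j ∈ Finset.univ.erase i, lennardJones (dist (xf i) (xf j)) :=
    two_mul_interactionEnergy lennardJones xf
  -- (E13) sizes
  have hcardB : Bset.card = n := by
    rw [hBset, Finset.card_image_of_injective _ hminj, Finset.card_univ, Fintype.card_fin]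
  have hcardA : (Aset.card : ℝ) + n = P.motif.card := by
    have h := Finset.card_sdiff_add_card_eq_card hBsub
    rw [← hAset, hcardB] at h
    exact_mod_cast h
  -- assemble
  have hsum9 : ∑ i, siteP (xf i) = ∑ i, SA i + ∑ i, siteB (xf i) := by
    rw [← Finset.sum_add_distrib]; exact Finset.sum_congr rfl fun i _ => hE9 i
  have hsum10 : ∑ i, siteB (xf i) = ∑ i, ∑ j ∈ Finset.univ.erase i, lennardJones (dist (xf i) (xf j)) + ∑ i, G i := by
    rw [← Finset.sum_add_distrib]; exact Finset.sum_congr rfl fun i _ => hE10 i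
  have hsum11 : ∑ i, I i = ∑ i, SA i + ∑ i, G i := by
    rw [← Finset.sum_add_distrib]; exact Finset.sum_congr rfl fun i _ => hE11 i
  have hGsum : ∑ i, G i ≤ 0 := Finset.sum_nonpos fun i _ => hGle i
  have hApos : (0 : ℝ) ≤ Aset.card := Nat.cast_nonneg _
  have hv : e * n < interactionEnergy lennardJones xf + ∑ i, I i := hviol
  have hcardA' : 2 * (Aset.card : ℝ) * e + 2 * (n : ℝ) * e = 2 * (P.motif.card : ℝ) * e := by rw [← hcardA]; ring
  linarith [hE1, hE3, hE4, hE4', hE5, hE68, hsum9, hsum10, hsum11, hGsum, hE12, hcardA', hv]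

end Summit.AtomisticToContinuum.Crystallization.Theorems.FrustratedLawDichotomyPeriodicRemovalTest

end
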